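import Summits.FinalStateConjecture.FinalStateConjecture.Theorems.BartnikGapSettlingGapExhaustionIKLocalStep
import Summits.FinalStateConjecture.FinalStateConjecture.Theorems.BartnikGapSettlingGapExhaustionIKStepNormalisedDataT
import Literature.Geometry.Lorentzian.KerrRpBulk
import Literature.Geometry.Lorentzian.KerrConvergenceProofs
import HarnessLib

/-!
# Crux `GapExhaustion` (stmt-FinalStateConjecture-10808), line `photon-shell-pseudoconvexity`:
# stub (V-6T) `ikLocalStepT_of_constants` — the local step of the `T`-CONDITIONAL sweep in a
# stationary chart, CONSTANTS FIRST, LABEL LATER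

Route `BartnikGapSettling`; helper (`--supports stmt-FinalStateConjecture-10808`) of line lead
c12 (S6b‴ chain). The conditional twin of `ikLocalStep_of_constants` (V-6): Ionescu–Klainerman's
`T`-conditional local extension theorem in chart form with a CONSTANT conditioning field
(Surveys Diff. Geom. 20 (2015) Thm 2.4 with Def. 2.2 / Lemma 2.17; the hypothesis `hIKC`,
verbatim the crux skeleton's `IKConditionalLocalKillingExtension`) replaces the unconditional
one, the multiplier form is the `T`-CONDITIONAL one of brick UU-T with the stationary direction
`∂₀` as conditioning vector (valid on EVERY band `r₊ < r_lo < r_e`, belt and ergoregion included),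
the chart is STATIONARY on the tube (`G (z + t ∂₀) = G z`), the Killing datum commutes with `∂₀`
(`∂₀ k = 0`), and so does the extension. New ingredients relative to V-6: the stationary
direction `τ = Ls⁻¹ ∂₀` of the normalised chart with `A₁⁻¹ ≤ ‖τ‖ ≤ A₁` and the second penalty
(`stub_ikQuant6T`, N-6cT), and four invariance transports (normalised metric, defining function,
datum, extension) — directional derivatives of translation-invariant maps and chain rules
through the affine change `y ↦ x + Ls y`.
-/

noncomputable section

set_option maxSynthPendingDepth 3

-- D-0017: single-problem summit, `Summit.<S>.<S>.…` by design (cf. lakefile `weak.linter.dupNamespace`).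
set_option linter.dupNamespace false

namespace Summit.FinalStateConjecture.FinalStateConjecture.Theorems

open Set Function Metric
open Literature.Geometry.Lorentzian Literature.Geometry.Lorentzian.MetricCoord
open scoped Manifold ContDiff Topology ENNReal

/-! ### Invariance transports -/

/-- A map differentiable at `y` which is invariant under the translations `y ↦ y + t • v` near
`t = 0` has vanishing derivative along `v`. [folklore] -/
theorem ikStepT_fderiv_eq_zero_of_forall_add_smul {F : Type*} [NormedAddCommGroup F]
    [NormedSpace ℝ F] {g : E4 → F} {y v : E4} (hg : DifferentiableAt ℝ g y)
    (hinv : ∀ t : ℝ, g (y + t • v) = g y) : fderiv ℝ g y v = 0 := by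
  have hline : HasLineDerivAt ℝ g (fderiv ℝ g y v) y v := hg.hasFDerivAt.hasLineDerivAt v
  have hconst : HasLineDerivAt ℝ g 0 y v := by
    have h : HasDerivAt (fun t : ℝ => g (y + t • v)) 0 0 := by
      have : (fun t : ℝ => g (y + t • v)) = fun _ => g y := funext hinv
      rw [this]; exact hasDerivAt_const 0 (g y)
    exact h
  exact hline.unique hconst

/-- Chain rule along a vector through the affine change: for `kt y = Λ (k (x + Ls y))` with `Λ`
linear and `k` differentiable at `x + Ls y`, `D kt(y) v = Λ (D k(x + Ls y) (Ls v))`. [folklore] -/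
theorem ikStepT_fderiv_comp_affine_apply : ∀ (k : E4 → E4) (x y v : E4) (Ls : E4 ≃L[ℝ] E4)
    (Λ : E4 →L[ℝ] E4), DifferentiableAt ℝ k (x + Ls y) →
    fderiv ℝ (fun y : E4 => Λ (k (x + Ls y))) y v = Λ (fderiv ℝ k (x + Ls y) (Ls v)) := by
  intro k x y v Ls Λ hk
  have haff : HasFDerivAt (fun y : E4 => x + Ls y) (Ls : E4 →L[ℝ] E4) y :=
    affineCov_hasFDerivAt Ls x y
  have hcomp : HasFDerivAt (fun y : E4 => k (x + Ls y)) ((fderiv ℝ k (x + Ls y)).comp (Ls : E4 →L[ℝ] E4)) y :=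
    hk.hasFDerivAt.comp y haff
  have hfull : HasFDerivAt (fun y : E4 => Λ (k (x + Ls y)))
      (Λ.comp ((fderiv ℝ k (x + Ls y)).comp (Ls : E4 →L[ℝ] E4))) y :=
    Λ.hasFDerivAt.comp y hcomp
  rw [hfull.fderiv]
  rfl

set_option maxHeartbeats 400000 in
/-- **The local step of the `T`-conditional sweep in a stationary chart, constants first (from
Ionescu–Klainerman's `T`-conditional local extension theorem in chart form with a constant
conditioning field, the hypothesis `hIKC`).** For all constants `δU ε₁ ρ₀ L₃ ν CK δF` and every
input radius `ρ > 0` there is an output radius `ρ' > 0` such that, at every label `0 < M`,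
`|a| < M` and band `r₊ < r_lo < r_e` (no photon-shell restriction) at which the `T`-conditional
multiplier form holds with `(δU, ε₁)`, the order-`6` band regularity with `(ρ₀, L₃, ν, CK)` and
the exact-frame normalisation with `δF`: for every Ricci-flat spacetime and every chart `Φ`
smooth, openly embedded with injective differential on `{r > M}`, `min 1 (min δU δF)`-close to
`g_{M,a}` in `C⁶` on the tube `{(r₊ + r_lo)/2 ≤ r ≤ r_e + 1}` and STATIONARY there
(`Φ^*g (z + t ∂₀) = Φ^*g (z)`), every `C^∞` solution of the coordinate Killing equation on
`ball x ρ ∩ {r < c}` (`r x = c ∈ [r_lo, r_e]`) commuting with `∂₀` there extends to one on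
`ball x ρ'`, commuting with `∂₀` and agreeing below the cylinder.
[cite: IonescuKlainerman2015, Thm 2.4, Def. 2.2, Lemma 2.17] -/
theorem ikLocalStepT_of_constants :
    (∀ (A A₁ δ₀ : ℝ), 1 ≤ A → A ≤ A₁ → 0 < δ₀ → δ₀ ≤ 1 → ∃ δ₁ : ℝ, 0 < δ₁ ∧ δ₁ ≤ δ₀ ∧
      ∀ (G : E4 → E4 →L[ℝ] E4 →L[ℝ] ℝ) (f : E4 → ℝ) (p τ : E4) (Z : E4 → E4),
        MetricCoord.IsMetricOn G (Metric.ball p 1) →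
        (∀ x ∈ Metric.ball p 1, MetricCoord.ricAt G x = 0) →
        G p = Minkowski.bilin →
        ContDiffOn ℝ ∞ f (Metric.ball p 1) →
        (∀ x ∈ Metric.ball p 1,
          (∑ j ∈ Finset.Icc 1 6, ‖iteratedFDeriv ℝ j G x‖) +
            (∑ j ∈ Finset.Icc 1 4, ‖iteratedFDeriv ℝ j f x‖) ≤ A) →
        f p = 0 → A₁⁻¹ ≤ ‖fderiv ℝ f p‖ →
        A₁⁻¹ ≤ ‖τ‖ → ‖τ‖ ≤ A₁ →
        (∀ x ∈ Metric.ball p 1, fderiv ℝ G x τ = 0) →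
        (∀ x ∈ Metric.ball p 1, fderiv ℝ f x τ = 0) →
        (∃ μ ∈ Icc (-A₁) A₁, ∀ X : E4,
          A₁⁻¹ * ‖X‖ ^ 2 ≤ μ * G p X X - MetricCoord.hessAt G f p X X +
            A₁ * ((fderiv ℝ f p X) ^ 2 + (G p τ X) ^ 2)) →
        ContDiffOn ℝ ∞ Z (Metric.ball p δ₀ ∩ {x | f x < 0}) →
        (∀ x ∈ Metric.ball p δ₀ ∩ {x | f x < 0}, ∀ Y W : E4,
          fderiv ℝ G x (Z x) Y W + G x (fderiv ℝ Z x Y) W + G x Y (fderiv ℝ Z x W) = 0) →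
        (∀ x ∈ Metric.ball p δ₀ ∩ {x | f x < 0}, fderiv ℝ Z x τ = 0) →
        ∃ Z' : E4 → E4, ContDiffOn ℝ ∞ Z' (Metric.ball p δ₁) ∧
          (∀ x ∈ Metric.ball p δ₁, ∀ Y W : E4,
            fderiv ℝ G x (Z' x) Y W + G x (fderiv ℝ Z' x Y) W + G x Y (fderiv ℝ Z' x W) = 0) ∧
          (∀ x ∈ Metric.ball p δ₁, fderiv ℝ Z' x τ = 0) ∧
          EqOn Z' Z (Metric.ball p δ₁ ∩ {x | f x < 0})) →
    ∀ (δU ε₁ ρ₀ L₃ ν CK δF : ℝ), 0 < δU → 0 < ε₁ → 0 < ρ₀ → 0 ≤ L₃ → 0 < ν → 0 ≤ CK → 0 < δF →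
      ∀ ρ : ℝ, 0 < ρ → ∃ ρ' : ℝ, 0 < ρ' ∧
      ∀ (M a r_lo r_e : ℝ), 0 < M → |a| < M → Kerr.rPlus M a < r_lo → r_lo < r_e →
      -- (U-T) at this label and band, with the constants `δU`, `ε₁`
      (∀ (𝓢 : Spacetime.{0} 4) (Φ : E4 → 𝓢.carrier) (T : E4 → E4),
        ContMDiffOn 𝓘(ℝ, E4) (𝓡 4) ∞ Φ {z | M < Kerr.radius a z} →
        Topology.IsOpenEmbedding ({z : E4 | M < Kerr.radius a z}.restrict Φ) →
        supCkENorm {z | M < Kerr.radius a z ∧ r_lo ≤ Kerr.radius a z ∧ Kerr.radius a z ≤ r_e} 2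
            (fun z => 𝓢.metricInCoords Φ z - Kerr.bilin M a z) ≤ ENNReal.ofReal δU →
        (∀ z : E4, r_lo ≤ Kerr.radius a z → Kerr.radius a z ≤ r_e →
          ‖T z - E4.basisVector 0‖ ≤ δU) →
        ∀ z : E4, r_lo ≤ Kerr.radius a z → Kerr.radius a z ≤ r_e →
          ∃ μ : ℝ, |μ| ≤ ε₁⁻¹ ∧ ∀ w : E4,
            ε₁ ^ 2 * ‖w‖ ^ 2 ≤ μ * 𝓢.metricInCoords Φ z w w
              - hessAt (𝓢.metricInCoords Φ) (Kerr.radius a) z w w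
              + ε₁⁻¹ ^ 2 * ((𝓢.metricInCoords Φ z (T z) w) ^ 2
                + (fderiv ℝ (Kerr.radius a) z w) ^ 2)) →
      -- (N-2) at order `6` on this band, with the constants `ρ₀`, `L₃`, `ν`, `CK`
      (∀ z : E4, r_lo ≤ Kerr.radius a z → Kerr.radius a z ≤ r_e → ∀ w : E4, ‖w‖ ≤ ρ₀ →
        (Kerr.rPlus M a + r_lo) / 2 < Kerr.radius a (z + w) ∧
        |Kerr.radius a (z + w) - Kerr.radius a z| ≤ L₃ * ‖w‖ ∧
        ContDiffAt ℝ ∞ (Kerr.bilin M a) (z + w) ∧ ContDiffAt ℝ ∞ (Kerr.radius a) (z + w) ∧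
        ν ≤ ‖fderiv ℝ (Kerr.radius a) (z + w)‖ ∧
        ∀ j : ℕ, j ≤ 6 →
          ‖iteratedFDeriv ℝ j (Kerr.bilin M a) (z + w)‖ ≤ CK ∧
          ‖iteratedFDeriv ℝ j (Kerr.radius a) (z + w)‖ ≤ CK) →
      -- (N-6a) at this label, with the constant `δF`
      (∀ (S₀ : E4 →L[ℝ] E4 →L[ℝ] ℝ) (x : E4), M < Kerr.radius a x →
        (∀ v w : E4, S₀ v w = S₀ w v) → ‖S₀ - Kerr.bilin M a x‖ ≤ δF →
        ∃ L : E4 ≃L[ℝ] E4, (∀ v w : E4, S₀ (L v) (L w) = Minkowski.bilin v w) ∧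
          ‖(L : E4 →L[ℝ] E4)‖ ≤ 6 ∧ ‖(L.symm : E4 →L[ℝ] E4)‖ ≤ 6) →
      ∀ (𝓢 : Spacetime.{0} 4) [𝓢.metric.HasLeviCivita] (Φ : E4 → 𝓢.carrier),
        𝓢.metric.toPseudoRiemannianMetric.IsRicciFlat →
        ContMDiffOn 𝓘(ℝ, E4) (𝓡 4) ∞ Φ {z | M < Kerr.radius a z} →
        Topology.IsOpenEmbedding ({z : E4 | M < Kerr.radius a z}.restrict Φ) →
        (∀ z : E4, M < Kerr.radius a z → Function.Injective (mfderiv 𝓘(ℝ, E4) (𝓡 4) Φ z)) →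
        (∀ z : E4, (Kerr.rPlus M a + r_lo) / 2 ≤ Kerr.radius a z → Kerr.radius a z ≤ r_e + 1 →
          ∀ j : ℕ, j ≤ 6 →
            ‖iteratedFDeriv ℝ j (fun z => 𝓢.metricInCoords Φ z - Kerr.bilin M a z) z‖ ≤
              min 1 (min δU δF)) →
        (∀ z : E4, (Kerr.rPlus M a + r_lo) / 2 ≤ Kerr.radius a z → Kerr.radius a z ≤ r_e + 1 →
          ∀ t : ℝ, 𝓢.metricInCoords Φ (z + t • E4.basisVector 0) = 𝓢.metricInCoords Φ z) →
        ∀ c ∈ Icc r_lo r_e, ∀ x : E4, Kerr.radius a x = c → ∀ k : E4 → E4,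
          ContDiffOn ℝ ∞ k (ball x ρ ∩ {y | Kerr.radius a y < c}) →
          (∀ y ∈ ball x ρ ∩ {y | Kerr.radius a y < c}, ∀ Y Z : E4,
            fderiv ℝ (𝓢.metricInCoords Φ) y (k y) Y Z + 𝓢.metricInCoords Φ y (fderiv ℝ k y Y) Z
              + 𝓢.metricInCoords Φ y Y (fderiv ℝ k y Z) = 0) →
          (∀ y ∈ ball x ρ ∩ {y | Kerr.radius a y < c}, fderiv ℝ k y (E4.basisVector 0) = 0) →
          ∃ k' : E4 → E4, ContDiffOn ℝ ∞ k' (ball x ρ') ∧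
            (∀ y ∈ ball x ρ', ∀ Y Z : E4,
              fderiv ℝ (𝓢.metricInCoords Φ) y (k' y) Y Z + 𝓢.metricInCoords Φ y (fderiv ℝ k' y Y) Z
                + 𝓢.metricInCoords Φ y Y (fderiv ℝ k' y Z) = 0) ∧
            (∀ y ∈ ball x ρ', fderiv ℝ k' y (E4.basisVector 0) = 0) ∧
            EqOn k' k (ball x ρ' ∩ {y | Kerr.radius a y < c}) := by
  intro hIKC δU ε₁ ρ₀ L₃ ν CK δF _hδU hε₁ hρ₀ hL₃ hν hCK _hδF ρ hρ
  -- the scale `s`: `6 s ≤ t / 2` with `t = min (min ρ₀ (1 / (L₃ + 1))) ρ`, and `s ≤ 1 / 12`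
  set t : ℝ := min (min ρ₀ (1 / (L₃ + 1))) ρ with htdef
  have htpos : 0 < t := lt_min (lt_min hρ₀ (by positivity)) hρ
  have htρ₀ : t ≤ ρ₀ := (min_le_left _ _).trans (min_le_left _ _)
  have htL : t ≤ 1 / (L₃ + 1) := (min_le_left _ _).trans (min_le_right _ _)
  have htρ : t ≤ ρ := min_le_right _ _
  set s : ℝ := min 1 t / 12 with hsdef
  have hspos : 0 < s := by positivity
  have hs1 : s ≤ 1 := by
    have : min 1 t ≤ 1 := min_le_left _ _
    rw [hsdef]; linarith only [this]
  have hst : 12 * s ≤ t := by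
    have : min 1 t ≤ t := min_le_right _ _
    rw [hsdef]; linarith only [this]
  have hs0 : s ≠ 0 := hspos.ne'
  -- IK constants (the extra `6 / s` bounds `‖τ‖ = ‖Ls⁻¹ ∂₀‖`)
  set A : ℝ := 1 + 6 * (6 ^ 8 * (CK + 1)) + 4 * (6 ^ 4 * CK) / s with hAdef
  have hA1 : 1 ≤ A := by
    have h1 : 0 ≤ 6 * (6 ^ 8 * (CK + 1)) := by positivity
    have h2 : 0 ≤ 4 * (6 ^ 4 * CK) / s := by positivity
    rw [hAdef]; linarith only [h1, h2]
  set A₁ : ℝ := max A (max (36 * ε₁⁻¹ ^ 2) (max ε₁⁻¹ (max (6 / ν) (6 / s)))) with hA₁def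
  have hAA₁ : A ≤ A₁ := le_max_left _ _
  have hA₁pos : 0 < A₁ := lt_of_lt_of_le (lt_of_lt_of_le one_pos hA1) hAA₁
  have hA₁ε2 : 36 * ε₁⁻¹ ^ 2 ≤ A₁ := (le_max_left _ _).trans (le_max_right _ _)
  have hA₁ε : ε₁⁻¹ ≤ A₁ := ((le_max_left _ _).trans (le_max_right _ _)).trans (le_max_right _ _)
  have hA₁ν : 6 / ν ≤ A₁ :=
    (((le_max_left _ _).trans (le_max_right _ _)).trans (le_max_right _ _)).trans (le_max_right _ _)
  have hA₁s : 6 / s ≤ A₁ :=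
    (((le_max_right _ _).trans (le_max_right _ _)).trans (le_max_right _ _)).trans (le_max_right _ _)
  obtain ⟨δ₁, hδ₁, hδ₁1, hIKC'⟩ := hIKC A A₁ 1 hA1 hAA₁ one_pos le_rfl
  refine ⟨s * δ₁ / 6, by positivity, ?_⟩
  intro M a r_lo r_e hM _ha hlo _hloe hU hband hF 𝓢 _ Φ hRF hΦ hemb hinjd hclose hstat c hc x hx
    k hk hkeq hkinv
  -- label-level facts and the tolerance `δ = min 1 (min δU δF)`
  have hrpM : M ≤ Kerr.rPlus M a := le_add_of_nonneg_right (Real.sqrt_nonneg _)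
  set δ : ℝ := min 1 (min δU δF) with hδdef
  have hδ1 : δ ≤ 1 := min_le_left _ _
  have hδU' : δ ≤ δU := (min_le_right _ _).trans (min_le_left _ _)
  have hδF' : δ ≤ δF := (min_le_right _ _).trans (min_le_right _ _)
  -- the chart components as a metric datum on the star domain `W = {r > M}`
  set G : E4 → E4 →L[ℝ] E4 →L[ℝ] ℝ := 𝓢.metricInCoords Φ with hGdef
  set W : Set E4 := {z | M < Kerr.radius a z} with hWdef
  have hW : IsOpen W := isOpen_lt continuous_const (Kerr.continuous_radius a)
  have hGmet : IsMetricOn G W := stub_isMetricOn_metricInCoords 𝓢 Φ W hW hΦ hinjd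
  have hGsm : ContDiffOn ℝ ∞ G W := hGmet.contDiffOn
  have hric : ∀ z ∈ W, ricAt G z = 0 := fun z hz ↦
    killingLoc_ricAt_metricInCoords_eq_zero 𝓢 Φ W hW hΦ hinjd hRF hz
  -- the point `x` on the cylinder `{r = c}`
  have hxlo : r_lo ≤ Kerr.radius a x := hx ▸ hc.1
  have hxe : Kerr.radius a x ≤ r_e := hx ▸ hc.2
  have hxM : M < Kerr.radius a x := by linarith only [hrpM, hlo, hxlo]
  have hxW : x ∈ W := hxM
  -- the exact frame at `x`
  have hGx_close : ‖G x - Kerr.bilin M a x‖ ≤ δF := by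
    have h := hclose x (by linarith only [hlo, hxlo]) (by linarith only [hxe]) 0 (Nat.zero_le _)
    rw [norm_iteratedFDeriv_zero] at h
    exact h.trans hδF'
  obtain ⟨L, hL, hL6, hLs6⟩ := hF (G x) x hxM (fun v w ↦ 𝓢.metricInCoords_symm Φ x v w) hGx_close
  obtain ⟨Ls, hLs, hLss⟩ := ikStep_exists_smul_equiv L hs0
  have hLs_apply : ∀ v : E4, Ls v = s • L v := fun v ↦ by
    simpa using DFunLike.congr_fun hLs v
  -- the affine chart `aff y = x + Ls y` and the tube facts at its points
  have htube : ∀ y : E4, ‖y‖ ≤ 1 →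
      x + Ls y ∈ ball x ρ ∧
      (Kerr.rPlus M a + r_lo) / 2 < Kerr.radius a (x + Ls y) ∧
      Kerr.radius a (x + Ls y) ≤ r_e + 1 ∧
      x + Ls y ∈ W ∧ 0 < Kerr.radius a (x + Ls y) ∧
      ContDiffAt ℝ ∞ (Kerr.bilin M a) (x + Ls y) ∧ ContDiffAt ℝ ∞ (Kerr.radius a) (x + Ls y) ∧
      ν ≤ ‖fderiv ℝ (Kerr.radius a) (x + Ls y)‖ ∧
      (∀ j : ℕ, j ≤ 6 → ‖iteratedFDeriv ℝ j (Kerr.bilin M a) (x + Ls y)‖ ≤ CK ∧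
        ‖iteratedFDeriv ℝ j (Kerr.radius a) (x + Ls y)‖ ≤ CK) ∧
      (∀ j : ℕ, j ≤ 6 → ‖iteratedFDeriv ℝ j G (x + Ls y)‖ ≤ CK + 1) := by
    intro y hy
    have hw : ‖Ls y‖ ≤ 6 * s := by
      calc ‖Ls y‖ ≤ ‖(Ls : E4 →L[ℝ] E4)‖ * ‖y‖ := (Ls : E4 →L[ℝ] E4).le_opNorm y
        _ ≤ 6 * s * 1 := by
            gcongr
            exact ikStep_norm_Ls hspos hLs hL6
        _ = 6 * s := by ring
    have hwt : ‖Ls y‖ ≤ t / 2 := by linarith only [hw, hst]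
    have hwρ₀ : ‖Ls y‖ ≤ ρ₀ := by linarith only [hwt, htρ₀, htpos]
    obtain ⟨hr1, hr2, hKs, hrs, hνy, hjb⟩ := hband x hxlo hxe (Ls y) hwρ₀
    have hball : x + Ls y ∈ ball x ρ := by
      rw [mem_ball, dist_eq_norm, add_sub_cancel_left]; linarith only [hwt, htρ, htpos]
    have hre1 : Kerr.radius a (x + Ls y) ≤ r_e + 1 := by
      have h1 : L₃ * ‖Ls y‖ ≤ L₃ * (1 / (L₃ + 1)) :=
        mul_le_mul_of_nonneg_left (by linarith only [hwt, htL, htpos]) hL₃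
      have h2 : L₃ * (1 / (L₃ + 1)) ≤ 1 := by
        rw [mul_one_div, div_le_one (by linarith only [hL₃])]; linarith only [hL₃]
      have h3 := (abs_le.1 hr2).2
      linarith only [h1, h2, h3, hxe]
    have hWy : x + Ls y ∈ W := by
      show M < Kerr.radius a (x + Ls y); linarith only [hr1, hrpM, hlo]
    have hr0y : 0 < Kerr.radius a (x + Ls y) := hM.trans hWy
    refine ⟨hball, hr1, hre1, hWy, hr0y, hKs, hrs, hνy, fun j hj ↦ hjb j hj, fun j hj ↦ ?_⟩
    have hGa : ContDiffAt ℝ j G (x + Ls y) :=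
      ((hGsm _ hWy).contDiffAt (hW.mem_nhds hWy)).of_le (by exact_mod_cast le_top)
    have hKa : ContDiffAt ℝ j (Kerr.bilin M a) (x + Ls y) := hKs.of_le (by exact_mod_cast le_top)
    have hDa : ContDiffAt ℝ j (fun z => G z - Kerr.bilin M a z) (x + Ls y) := hGa.sub hKa
    have hsplit : iteratedFDeriv ℝ j G (x + Ls y) =
        iteratedFDeriv ℝ j (Kerr.bilin M a) (x + Ls y) +
          iteratedFDeriv ℝ j (fun z => G z - Kerr.bilin M a z) (x + Ls y) := by
      rw [← iteratedFDeriv_add_apply hKa hDa]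
      congr 1
      funext z
      simp only [Pi.add_apply, add_sub_cancel]
    rw [hsplit]
    calc ‖iteratedFDeriv ℝ j (Kerr.bilin M a) (x + Ls y) +
          iteratedFDeriv ℝ j (fun z => G z - Kerr.bilin M a z) (x + Ls y)‖
        ≤ ‖iteratedFDeriv ℝ j (Kerr.bilin M a) (x + Ls y)‖ +
          ‖iteratedFDeriv ℝ j (fun z => G z - Kerr.bilin M a z) (x + Ls y)‖ := norm_add_le _ _
      _ ≤ CK + δ := add_le_add (hjb j hj).1 (hclose _ hr1.le hre1 j hj)
      _ ≤ CK + 1 := by linarith only [hδ1]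
  have haff0 : x + Ls 0 = x := by simp
  have hmem1 : ∀ y : E4, y ∈ ball (0 : E4) 1 → ‖y‖ ≤ 1 := fun y hy ↦ (mem_ball_zero_iff.1 hy).le
  -- the `T`-conditional multiplier form (IK Surveys 2015 Lemma 2.17) at `x`, conditioning vector `∂₀`
  have hsup : supCkENorm {z | M < Kerr.radius a z ∧ r_lo ≤ Kerr.radius a z ∧ Kerr.radius a z ≤ r_e} 2
      (fun z => G z - Kerr.bilin M a z) ≤ ENNReal.ofReal δU := by
    refine ikStep_supCkENorm_le fun z hz m hm ↦ ?_
    exact (hclose z (by linarith only [hz.2.1, hlo]) (by linarith only [hz.2.2]) m (by omega)).trans hδU'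
  obtain ⟨μ₀, hμ₀, hUin⟩ := hU 𝓢 Φ (fun _ => E4.basisVector 0) hΦ hemb hsup
    (fun z _ _ ↦ by simp [_hδU.le]) x hxlo hxe
  -- the normalised data (opaque names with defining equations)
  obtain ⟨Gt, hGt⟩ : ∃ Gt : E4 → E4 →L[ℝ] E4 →L[ℝ] ℝ, ∀ y : E4, Gt y =
      (s ^ 2)⁻¹ • (G (x + Ls y)).bilinearComp (Ls : E4 →L[ℝ] E4) (Ls : E4 →L[ℝ] E4) :=
    ⟨_, fun _ ↦ rfl⟩
  obtain ⟨ft, hft⟩ : ∃ ft : E4 → ℝ, ∀ y : E4, ft y = (s ^ 2)⁻¹ * (Kerr.radius a (x + Ls y) - c) :=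
    ⟨_, fun _ ↦ rfl⟩
  obtain ⟨kt, hkt⟩ : ∃ kt : E4 → E4, ∀ y : E4, kt y = (Ls.symm : E4 →L[ℝ] E4) (k (x + Ls y)) :=
    ⟨_, fun _ ↦ rfl⟩
  obtain ⟨τ, hτ⟩ : ∃ τ : E4, τ = (Ls.symm : E4 →L[ℝ] E4) (E4.basisVector 0) := ⟨_, rfl⟩
  have hLsτ : Ls τ = E4.basisVector 0 := by rw [hτ]; exact Ls.apply_symm_apply _
  -- IK's hypotheses at `p = 0`
  obtain ⟨hGtmetW, hGtricW, hGt0, -, -⟩ := ikStep_Gt_basic hGmet hric hspos hLs_apply hL hGt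
  have hball_sub : ball (0 : E4) 1 ⊆ (fun y : E4 => x + Ls y) ⁻¹' W := fun y hy ↦
    (htube y (hmem1 y hy)).2.2.2.1
  have hGtmet : IsMetricOn Gt (ball 0 1) := ikStep_isMetricOn_mono hGtmetW isOpen_ball hball_sub
  have hGtric : ∀ y ∈ ball (0 : E4) 1, ricAt Gt y = 0 := fun y hy ↦ hGtricW y (hball_sub hy)
  have hr0x : ContDiffAt ℝ ∞ (Kerr.radius a) x := by
    have h := (htube 0 (by simp)).2.2.2.2.2.2.1
    rwa [haff0] at h
  have hνx : ν ≤ ‖fderiv ℝ (Kerr.radius a) x‖ := by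
    have h := (htube 0 (by simp)).2.2.2.2.2.2.2.1
    rwa [haff0] at h
  obtain ⟨hft0, -, -, hftcd⟩ := ikStep_ft_basic hspos hLs_apply hx hft hr0x
  have hft_cd : ContDiffOn ℝ ∞ ft (ball 0 1) := fun y hy ↦
    (hftcd y (htube y (hmem1 y hy)).2.2.2.2.2.2.1).contDiffWithinAt
  have hAbound : ∀ y ∈ ball (0 : E4) 1,
      (∑ j ∈ Finset.Icc 1 6, ‖iteratedFDeriv ℝ j Gt y‖) +
        (∑ j ∈ Finset.Icc 1 4, ‖iteratedFDeriv ℝ j ft y‖) ≤ A := by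
    intro y hy
    obtain ⟨-, -, -, hyW, hr0y, -, -, -, hjb, hjG⟩ := htube y (hmem1 y hy)
    have h := ikStep_bound_A hGmet hspos hs1 hLs hL6 hGt hft hCK hyW hr0y (fun j hj ↦ (hjb j hj).2) hjG
    rw [hAdef]; linarith only [h]
  obtain ⟨hft_norm, hτlo, hτhi, hq6⟩ := stub_ikQuant6T G W a c s x L Ls Gt ft τ ν ε₁ μ₀ A₁ hGmet hric
    hxW hspos hs1 hLs_apply hL hL6 hLs6 hGt hx hft hτ hr0x hν hε₁ hA₁pos hνx hμ₀ hUin hA₁ε2 hA₁ε hA₁ν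
    hA₁s
  -- invariance of the normalised metric and of the defining function along `τ`
  have hGtinv : ∀ y ∈ ball (0 : E4) 1, fderiv ℝ Gt y τ = 0 := by
    intro y hy
    obtain ⟨-, hr1, hre1, hyW, -⟩ := htube y (hmem1 y hy)
    have hd : DifferentiableAt ℝ Gt y :=
      ((hGtmet.contDiffOn y hy).contDiffAt (isOpen_ball.mem_nhds hy)).differentiableAt (by simp)
    refine ikStepT_fderiv_eq_zero_of_forall_add_smul hd fun t' ↦ ?_
    rw [hGt, hGt, map_add, map_smul, hLsτ, ← add_assoc, hstat _ hr1.le hre1 t']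
  have hftinv : ∀ y ∈ ball (0 : E4) 1, fderiv ℝ ft y τ = 0 := by
    intro y hy
    have hd : DifferentiableAt ℝ ft y :=
      ((hft_cd y hy).contDiffAt (isOpen_ball.mem_nhds hy)).differentiableAt (by simp)
    refine ikStepT_fderiv_eq_zero_of_forall_add_smul hd fun t' ↦ ?_
    have hsp : E4.spatial (x + Ls y + t' • E4.basisVector 0) = E4.spatial (x + Ls y) := by
      have h0 : E4.spatial (E4.basisVector 0) = 0 := by ext i; simp
      rw [map_add, map_smul, h0, smul_zero, add_zero]
    rw [hft, hft, map_add, map_smul, hLsτ, ← add_assoc, Kerr.radius_eq_of_spatial_eq a hsp]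
  -- the datum in the normalised chart and its invariance
  obtain ⟨hkt_cd, hkt_eq⟩ := ikStep_kt_input hGmet hspos hGt hft hk hkeq
    (fun y hy ↦ ⟨(htube y hy).1, (htube y hy).2.2.2.1⟩) hkt
  have hO : IsOpen (ball x ρ ∩ {y | Kerr.radius a y < c}) :=
    isOpen_ball.inter (isOpen_lt (Kerr.continuous_radius a) continuous_const)
  have hktinv : ∀ y ∈ ball (0 : E4) 1 ∩ {y | ft y < 0}, fderiv ℝ kt y τ = 0 := by
    rintro y ⟨hy, hyf⟩
    have hyc : Kerr.radius a (x + Ls y) < c := by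
      have h : (s ^ 2)⁻¹ * (Kerr.radius a (x + Ls y) - c) < 0 := by rw [← hft]; exact hyf
      have hs2 : (0 : ℝ) ≤ (s ^ 2)⁻¹ := inv_nonneg.2 (sq_nonneg s)
      exact sub_neg.1 (neg_of_mul_neg_right h hs2)
    have hmem : x + Ls y ∈ ball x ρ ∩ {y | Kerr.radius a y < c} := ⟨(htube y (hmem1 y hy)).1, hyc⟩
    have hkd : DifferentiableAt ℝ k (x + Ls y) :=
      ((hk _ hmem).contDiffAt (hO.mem_nhds hmem)).differentiableAt (by simp)
    rw [funext hkt, ikStepT_fderiv_comp_affine_apply _ _ _ _ Ls (Ls.symm : E4 →L[ℝ] E4) hkd, hLsτ,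
      hkinv _ hmem, map_zero]
  -- Ionescu–Klainerman (conditional) at the origin of the normalised chart
  obtain ⟨Z', hZ'cd, hZ'eq, hZ'inv, hZ'agree⟩ :=
    hIKC' Gt ft 0 τ kt hGtmet hGtric hGt0 hft_cd hAbound hft0 hft_norm hτlo hτhi hGtinv hftinv hq6
      hkt_cd hkt_eq hktinv
  -- back to the chart `Φ`
  obtain ⟨k', hk'⟩ : ∃ k' : E4 → E4, ∀ y' : E4,
      k' y' = Ls (Z' ((Ls.symm : E4 →L[ℝ] E4) (y' - x))) := ⟨_, fun _ ↦ rfl⟩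
  obtain ⟨h1, h2, h3⟩ := stub_ikKillingBack G W a c s x L Ls Gt ft k kt Z' k' δ₁ hGmet hspos hLss hLs6
    hGt hft (fun y hy ↦ (htube y hy).2.2.2.1) hkt hδ₁1 hZ'cd hZ'eq hZ'agree hk'
  refine ⟨k', h1, h2, fun y' hy' ↦ ?_, h3⟩
  -- invariance of the extension: `D k'(y') ∂₀ = Ls (D Z'(w) τ)`, `w = Ls⁻¹ (y' − x) ∈ ball 0 δ₁`
  have hw : (Ls.symm : E4 →L[ℝ] E4) (y' - x) ∈ ball (0 : E4) δ₁ := by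
    rw [mem_ball_zero_iff]
    rw [mem_ball, dist_eq_norm] at hy'
    calc ‖(Ls.symm : E4 →L[ℝ] E4) (y' - x)‖ ≤ ‖(Ls.symm : E4 →L[ℝ] E4)‖ * ‖y' - x‖ :=
          (Ls.symm : E4 →L[ℝ] E4).le_opNorm _
      _ ≤ (6 / s) * ‖y' - x‖ := by
          gcongr
          rw [hLss, norm_smul, Real.norm_eq_abs, abs_of_pos (inv_pos.2 hspos), div_eq_inv_mul]
          exact mul_le_mul_of_nonneg_left hLs6 (inv_pos.2 hspos).le
      _ < (6 / s) * (s * δ₁ / 6) := by gcongr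
      _ = δ₁ := by field_simp
  have hZd : DifferentiableAt ℝ Z' ((Ls.symm : E4 →L[ℝ] E4) (y' - x)) :=
    ((hZ'cd _ hw).contDiffAt (isOpen_ball.mem_nhds hw)).differentiableAt (by simp)
  have hrew : k' = fun y' : E4 => (Ls : E4 →L[ℝ] E4) (Z' ((-((Ls.symm : E4 →L[ℝ] E4) x)) +
      Ls.symm y')) := by
    funext z; rw [hk', map_sub]; simp only [ContinuousLinearEquiv.coe_coe]; abel_nf
  have hpt : (-((Ls.symm : E4 →L[ℝ] E4) x)) + Ls.symm y' = (Ls.symm : E4 →L[ℝ] E4) (y' - x) := by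
    rw [map_sub]; simp only [ContinuousLinearEquiv.coe_coe]; abel
  have hτ' : Ls.symm (E4.basisVector 0) = τ := by rw [hτ]; rfl
  rw [hrew, ikStepT_fderiv_comp_affine_apply _ _ _ _ Ls.symm (Ls : E4 →L[ℝ] E4) (by rw [hpt]; exact hZd), hpt,
    hτ', hZ'inv _ hw, map_zero]

end Summit.FinalStateConjecture.FinalStateConjecture.Theorems

end
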